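import Mathlib.Tactic
import Literature.Computability.AlgebraicComplexity.SetMultilinear
import Summits.ValiantsHypothesis.ValiantsHypothesis.Theorems.BlockLaplaceCircuit
import Summits.ValiantsHypothesis.ValiantsHypothesis.Theorems.GlueLeafCount
import HarnessLib

/-!
# Depth-4 row-set-multilinear expressions of the permanent: WLOG linear bottoms
(decomposition workshop `decomp-valiant`, lens 6 «restricted-models lifting axis», gen 3 — the
first half of the ladder edge `A_c ⟹ A^ΣΠΣΠ_c` of NODE-v3, typed)

In `Theorems.RowSmlDepthFour` the depth-4 rung `PerRowSmlDepthFourHardExp c` quantifies over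
expressions `per_n = Σ_t Π_b Σ_u Π_{i ∈ b} q_{t,b,u,i}` whose bottoms `q_{t,b,u,i}` are ARBITRARY
polynomials in the variables of row `i`. This file proves that the bottoms may be replaced by their
ROW-LINEAR PARTS (`smlProj Prod.fst {i}` = the component of degree exactly `1` in row `i`, a linear
form in `x_{i,1}, …, x_{i,n}`) without changing the value `per_n` or the size `Σ_t w_t`
(`perPoly_eq_depthFourEval_linearise`), hence hardness against LINEAR-bottom expressions already
gives the rung (`perRowSmlDepthFourHardExp_of_linear`). Mechanism: the set-multilinear projection
onto the full row profile (`Literature…smlProj Prod.fst univ`) fixes `per_n`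
(`BlockLaplaceCircuit.isSetMultilinear_perPoly`) and distributes over products of polynomials
living on DISJOINT row sets (`smlProj_prod_local`, from the two-factor formula
`Literature…smlProj_mul` plus the vanishing `smlProj_eq_zero_of_local`).

WHY IT MATTERS for the ladder: with linear bottoms the expression is literally a syntactically
multilinear formula of size `O((Σ_t w_t)·n²)`, so `PerSmHardExp c` (all syntactically multilinear
circuits) implies the depth-4 rung; the remaining circuit-construction half of that edge is routine
and not typed here.

HONEST FRAMING: unconditional algebra about identities for the permanent; nothing here is evidence
for `VP ≠ VNP`, which is NOT proved.

## References
* [LimayeSrinivasanTavenas2025] N. Limaye, S. Srinivasan, S. Tavenas, J. ACM (2025), §2 and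
  Claim 7 (set-multilinear projection and products over disjoint variable sets).
* [RazYehudayoff2009] R. Raz, A. Yehudayoff, Comput. Complexity 18 (2009), §2 (multilinear vs
  syntactically multilinear; homogeneous components).
-/

-- layout Summits/ValiantsHypothesis/ValiantsHypothesis forces the duplicated namespace component
set_option linter.dupNamespace false

namespace Summit.ValiantsHypothesis.ValiantsHypothesis.Theorems.DepthFourLinearise

open Finset MvPolynomial Literature.Computability.AlgebraicComplexity
open Summit.ValiantsHypothesis.ValiantsHypothesis.Theorems.RowSmlDepthFour
open Summit.ValiantsHypothesis.ValiantsHypothesis.Theorems.GlueLeafCount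

noncomputable section

variable {F : Type*} [Field F]

/-- A polynomial living on the rows `A` has no set-multilinear component on a block set not
contained in `A`. [cite: LimayeSrinivasanTavenas2025, §2] -/
theorem smlProj_eq_zero_of_local {n : ℕ} {A S₁ : Finset (Fin n)}
    {p : MvPolynomial (Fin n × Fin n) F}
    (hp : ∃ h : MvPolynomial {ij : Fin n × Fin n // ij.1 ∈ A} F, p = rename Subtype.val h)
    (hS : ¬ S₁ ⊆ A) :
    smlProj Prod.fst S₁ p = 0 := by
  classical
  obtain ⟨h, rfl⟩ := hp
  ext d
  rw [coeff_smlProj, coeff_zero]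
  split_ifs with hw
  · by_contra hc
    apply hS
    intro i hi
    have h1 : (Finsupp.weight (blockWeight (Prod.fst : Fin n × Fin n → Fin n)) d) i = 1 := by
      rw [hw, blockProfile_apply, if_pos hi]
    rw [weight_blockWeight_apply_eq, Finsupp.weight_apply, Finsupp.sum] at h1
    obtain ⟨v, hv, hvi⟩ : ∃ v ∈ d.support, v.1 = i := by
      by_contra hne
      push Not at hne
      rw [Finset.sum_eq_zero (fun v hv => by rw [if_neg (hne v hv), smul_zero])] at h1
      exact zero_ne_one h1
    have hvars : v ∈ (rename (Subtype.val : {ij : Fin n × Fin n // ij.1 ∈ A} → Fin n × Fin n) h).vars :=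
      (mem_vars_iff_mem_support v).2 ⟨d, mem_support_iff.2 hc, hv⟩
    obtain ⟨u, -, huv⟩ := Finset.mem_image.1 (vars_rename _ _ hvars)
    rw [← hvi, ← huv]
    exact u.2
  · rfl

/-- **Projection distributes over products on disjoint row sets**: if `P k` lives on the rows
`A k` (pairwise disjoint), the set-multilinear projection onto `⋃ A k` of `Π P k` is the product
of the projections onto the `A k`. [cite: LimayeSrinivasanTavenas2025, Claim 7] -/
theorem smlProj_prod_local {n : ℕ} {κ : Type*} [DecidableEq κ] (K : Finset κ)
    (A : κ → Finset (Fin n))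
    (hA : ∀ k ∈ K, ∀ k' ∈ K, k ≠ k' → Disjoint (A k) (A k'))
    (P : κ → MvPolynomial (Fin n × Fin n) F)
    (hP : ∀ k ∈ K, ∃ h : MvPolynomial {ij : Fin n × Fin n // ij.1 ∈ A k} F,
      P k = rename Subtype.val h)
    (S : Finset (Fin n)) (hS : S = K.biUnion A) :
    smlProj Prod.fst S (∏ k ∈ K, P k) = ∏ k ∈ K, smlProj Prod.fst (A k) (P k) := by
  classical
  subst hS
  induction K using Finset.induction_on with
  | empty => simp [smlProj_empty]
  | insert a K ha ih =>
    have hA' : ∀ k ∈ K, ∀ k' ∈ K, k ≠ k' → Disjoint (A k) (A k') :=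
      fun k hk k' hk' => hA k (mem_insert_of_mem hk) k' (mem_insert_of_mem hk')
    have hP' : ∀ k ∈ K, ∃ h : MvPolynomial {ij : Fin n × Fin n // ij.1 ∈ A k} F,
        P k = rename Subtype.val h := fun k hk => hP k (mem_insert_of_mem hk)
    have hU : Disjoint (A a) (K.biUnion A) := by
      rw [Finset.disjoint_biUnion_right]
      intro k hk
      exact hA a (mem_insert_self _ _) k (mem_insert_of_mem hk) (fun h => ha (h ▸ hk))
    -- the remaining product lives on `K.biUnion A`
    have hrest : ∃ h : MvPolynomial {ij : Fin n × Fin n // ij.1 ∈ K.biUnion A} F,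
        ∏ k ∈ K, P k = rename Subtype.val h :=
      isLocal_prod K P fun k hk => isLocal_mono (Finset.subset_biUnion_of_mem A hk) (hP' k hk)
    rw [Finset.prod_insert ha, Finset.prod_insert ha, Finset.biUnion_insert, smlProj_mul,
      Finset.sum_eq_single (A a)]
    · rw [Finset.union_sdiff_cancel_left hU, ih hA' hP']
    · intro S₁ hS₁ hne
      by_cases h1 : S₁ ⊆ A a
      · have h2 : ¬ ((A a ∪ K.biUnion A) \ S₁ ⊆ K.biUnion A) := by
          intro hsub
          apply hne
          refine Finset.Subset.antisymm h1 fun i hi => ?_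
          by_contra hiS
          have hmem : i ∈ (A a ∪ K.biUnion A) \ S₁ :=
            Finset.mem_sdiff.2 ⟨Finset.mem_union_left _ hi, hiS⟩
          exact Finset.disjoint_left.1 hU hi (hsub hmem)
        rw [smlProj_eq_zero_of_local hrest h2, mul_zero]
      · rw [smlProj_eq_zero_of_local (hP a (mem_insert_self _ _)) h1, zero_mul]
    · intro hnot
      exact absurd (Finset.mem_powerset.2 Finset.subset_union_left) hnot

/-- The row-linear part of a bottom polynomial: its set-multilinear projection onto the single
block `{i}` (the component of degree exactly `1` in row `i`). [cite: LimayeSrinivasanTavenas2025, §2] -/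
def linPart {n : ℕ} (i : Fin n) (p : MvPolynomial (Fin n × Fin n) F) :
    MvPolynomial (Fin n × Fin n) F :=
  smlProj Prod.fst {i} p

/-- The linear part is set-multilinear over `{i}` (every monomial is one variable of row `i`
when `p` lives on row `i`). [cite: LimayeSrinivasanTavenas2025, Lemma 12] -/
theorem isSetMultilinear_linPart {n : ℕ} (i : Fin n) (p : MvPolynomial (Fin n × Fin n) F) :
    IsSetMultilinear Prod.fst {i} (linPart i p) :=
  isSetMultilinear_smlProj _ _ _

/-- The linear part of a row-`i`-local polynomial is row-`i`-local. [folklore] -/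
theorem linPart_rowLocal {n : ℕ} (i : Fin n) {p : MvPolynomial (Fin n × Fin n) F}
    (hp : ∃ g : MvPolynomial (Fin n) F, p = rename (Prod.mk i) g) :
    ∃ g : MvPolynomial (Fin n) F, linPart i p = rename (Prod.mk i) g := by
  classical
  obtain ⟨g, rfl⟩ := hp
  have hinj : Function.Injective (Prod.mk i : Fin n → Fin n × Fin n) := fun a b h => by
    simpa using h
  obtain ⟨g', hg'⟩ := exists_rename_eq_of_vars_subset_range
    (linPart i (rename (Prod.mk i) g)) (Prod.mk i) hinj (by
      intro v hv
      obtain ⟨d, hd, hvd⟩ := (mem_vars_iff_mem_support v).1 (Finset.mem_coe.1 hv)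
      have hd' : d ∈ (rename (Prod.mk i) g).support := by
        rw [mem_support_iff] at hd ⊢
        rw [linPart, coeff_smlProj] at hd
        split_ifs at hd with hw
        · exact hd
        · exact absurd rfl hd
      have hv' : v ∈ (rename (Prod.mk i) g).vars := (mem_vars_iff_mem_support v).2 ⟨d, hd', hvd⟩
      obtain ⟨j, -, hj⟩ := Finset.mem_image.1 (vars_rename _ _ hv')
      exact ⟨j, hj⟩)
  exact ⟨g', hg'.symm⟩

/-- **Projection of a depth-4 row-set-multilinear expression** onto the full row profile =
the same expression with linearised bottoms. [cite: LimayeSrinivasanTavenas2025, Claim 7] -/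
theorem smlProj_depthFourEval (n s : ℕ) (w : Fin s → ℕ) (π : Fin s → Fin n → Fin n)
    (q : (t : Fin s) → Fin n → Fin (w t) → Fin n → MvPolynomial (Fin n × Fin n) F)
    (hq : ∀ t b u i, ∃ g : MvPolynomial (Fin n) F, q t b u i = rename (Prod.mk i) g) :
    smlProj Prod.fst univ (depthFourEval n s w π q) =
      depthFourEval n s w π (fun t b u i => linPart i (q t b u i)) := by
  classical
  unfold depthFourEval
  rw [map_sum]
  refine Finset.sum_congr rfl fun t _ => ?_
  -- blocks of term `t`: the fibres of `π t`, pairwise disjoint, covering all rows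
  have hfib : ∀ b ∈ univ.image (π t), ∀ b' ∈ univ.image (π t), b ≠ b' →
      Disjoint (univ.filter fun i => π t i = b) (univ.filter fun i => π t i = b') := by
    intro b _ b' _ hbb'
    rw [Finset.disjoint_filter]
    intro i _ hib hib'
    exact hbb' (hib.symm.trans hib')
  have hcov : (univ : Finset (Fin n)) =
      (univ.image (π t)).biUnion (fun b => univ.filter fun i => π t i = b) := by
    ext i
    simp only [Finset.mem_univ, Finset.mem_biUnion, Finset.mem_image, Finset.mem_filter,
      true_and, true_iff]
    exact ⟨π t i, ⟨i, rfl⟩, rfl⟩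
  -- each middle sum lives on its block
  have hmid : ∀ b ∈ univ.image (π t),
      ∃ h : MvPolynomial {ij : Fin n × Fin n // ij.1 ∈ univ.filter fun i => π t i = b} F,
        (∑ u : Fin (w t), ∏ i ∈ univ.filter (fun i => π t i = b), q t b u i) =
          rename Subtype.val h := by
    intro b _
    refine isLocal_sum _ _ fun u _ => isLocal_prod _ _ fun i hi => ?_
    exact isLocal_of_rowLocal hi (hq t b u i)
  rw [smlProj_prod_local (univ.image (π t)) (fun b => univ.filter fun i => π t i = b) hfib
    (fun b => ∑ u : Fin (w t), ∏ i ∈ univ.filter (fun i => π t i = b), q t b u i) hmid univ hcov]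
  refine Finset.prod_congr rfl fun b hb => ?_
  rw [map_sum]
  refine Finset.sum_congr rfl fun u _ => ?_
  -- inside a block: rows are the singleton blocks
  have hsing : ∀ i ∈ univ.filter (fun i => π t i = b), ∀ i' ∈ univ.filter (fun i => π t i = b),
      i ≠ i' → Disjoint ({i} : Finset (Fin n)) {i'} := by
    intro i _ i' _ hii'
    exact Finset.disjoint_singleton.2 hii'
  have hcov' : (univ.filter fun i => π t i = b) =
      (univ.filter fun i => π t i = b).biUnion (fun i => ({i} : Finset (Fin n))) :=
    (Finset.biUnion_singleton_eq_self).symm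
  have hbot : ∀ i ∈ univ.filter (fun i => π t i = b),
      ∃ h : MvPolynomial {ij : Fin n × Fin n // ij.1 ∈ ({i} : Finset (Fin n))} F,
        q t b u i = rename Subtype.val h :=
    fun i _ => isLocal_of_rowLocal (Finset.mem_singleton_self i) (hq t b u i)
  rw [smlProj_prod_local (univ.filter fun i => π t i = b) (fun i => ({i} : Finset (Fin n))) hsing
    (fun i => q t b u i) hbot _ hcov']
  rfl

/-- **WLOG linear bottoms.** A depth-4 row-set-multilinear expression for `per_n` stays one after
linearising every bottom polynomial (same top fan-in, same block partitions, same inner fan-ins).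
[cite: LimayeSrinivasanTavenas2025, Claim 7; RazYehudayoff2009, §2] -/
theorem perPoly_eq_depthFourEval_linearise (n s : ℕ) (w : Fin s → ℕ) (π : Fin s → Fin n → Fin n)
    (q : (t : Fin s) → Fin n → Fin (w t) → Fin n → MvPolynomial (Fin n × Fin n) F)
    (hq : ∀ t b u i, ∃ g : MvPolynomial (Fin n) F, q t b u i = rename (Prod.mk i) g)
    (h : perPoly (Fin n) F = depthFourEval n s w π q) :
    perPoly (Fin n) F = depthFourEval n s w π (fun t b u i => linPart i (q t b u i)) := by
  rw [← smlProj_depthFourEval n s w π q hq, ← h]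
  exact ((BlockLaplaceCircuit.isSetMultilinear_perPoly F n).smlProj_eq _).symm

/-- Hardness against LINEAR-bottom depth-4 row-set-multilinear expressions already gives the rung
`PerRowSmlDepthFourHardExp c` of `Theorems.RowSmlDepthFour`. [cite: RazYehudayoff2009, §2] -/
theorem perRowSmlDepthFourHardExp_of_linear (c : ℕ)
    (hlin : ∀ a : ℕ, ∃ m : ℕ, ∀ (s : ℕ) (w : Fin s → ℕ) (π : Fin s → Fin (m * c) → Fin (m * c))
      (q : (t : Fin s) → Fin (m * c) → Fin (w t) → Fin (m * c) →
        MvPolynomial (Fin (m * c) × Fin (m * c)) ℂ),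
      (∀ t b u i, ∃ g : MvPolynomial (Fin (m * c)) ℂ, q t b u i = rename (Prod.mk i) g) →
      (∀ t b u i, IsSetMultilinear Prod.fst {i} (q t b u i)) →
      perPoly (Fin (m * c)) ℂ = depthFourEval (m * c) s w π q →
        a * (m + 1) ^ a * 4 ^ m < ∑ t, w t) :
    PerRowSmlDepthFourHardExp c := by
  intro a
  obtain ⟨m, hm⟩ := hlin a
  refine ⟨m, fun s w π q hq h => ?_⟩
  exact hm s w π (fun t b u i => linPart i (q t b u i)) (fun t b u i => linPart_rowLocal i (hq t b u i))
    (fun t b u i => isSetMultilinear_linPart i (q t b u i))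
    (perPoly_eq_depthFourEval_linearise (m * c) s w π q hq h)

/-- The linear-bottom restriction of the rung, as a named statement. [cite: RazYehudayoff2009, §2] -/
def PerRowSmlDepthFourLinHardExp (c : ℕ) : Prop :=
  ∀ a : ℕ, ∃ m : ℕ, ∀ (s : ℕ) (w : Fin s → ℕ) (π : Fin s → Fin (m * c) → Fin (m * c))
    (q : (t : Fin s) → Fin (m * c) → Fin (w t) → Fin (m * c) →
      MvPolynomial (Fin (m * c) × Fin (m * c)) ℂ),
    (∀ t b u i, ∃ g : MvPolynomial (Fin (m * c)) ℂ, q t b u i = rename (Prod.mk i) g) →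
    (∀ t b u i, IsSetMultilinear Prod.fst {i} (q t b u i)) →
    perPoly (Fin (m * c)) ℂ = depthFourEval (m * c) s w π q →
      a * (m + 1) ^ a * 4 ^ m < ∑ t, w t

/-- **WLOG linear bottoms, as an equivalence of rungs.** [cite: RazYehudayoff2009, §2] -/
theorem perRowSmlDepthFourHardExp_iff_linear (c : ℕ) :
    PerRowSmlDepthFourHardExp c ↔ PerRowSmlDepthFourLinHardExp c := by
  refine ⟨fun h a => ?_, fun h => perRowSmlDepthFourHardExp_of_linear c h⟩
  obtain ⟨m, hm⟩ := h a
  exact ⟨m, fun s w π q hq _ hper => hm s w π q hq hper⟩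

end

end Summit.ValiantsHypothesis.ValiantsHypothesis.Theorems.DepthFourLinearise
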